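import Literature.Probability.LatticeModels.LatticeRatioLimit
import Literature.Probability.LatticeModels.PlanarIsingLogDerivative
import HarnessLib

/-!
# CHI Theorem 1.3 (`k = 0`) from Theorem 1.5 in its printed `Re 𝒜_Ω` form

Topic `Literature/Probability/LatticeModels`. The last purely formal link of the reduction of the
named fact `Literature.Probability.LatticeModels.chi_onePoint_rho` (Chelkak–Hongler–Izyurov 2015
= CHI15, Thm 1.3 for `k = 0`) to the outputs of CHI's spinor-observable analysis:
`LatticeRatioLimit.chi_onePoint_rho_of_logDerivative` takes the discrete logarithmic derivatives of
the `+` two-point function along diagonal steps with limit *the derivative of the explicit*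
`log ⟨σ_xσ_w⟩⁺_Ω`; `PlanarIsingLogDerivative.fderiv_log_twoPointPlusCHI_apply` computes that
derivative as `Re[𝒜_Ω(w; x) s]` (CHI15 Remark 2.21). Substituting one into the other gives the
reduction with hypothesis `hD` **literally in the form of CHI15 Theorem 1.5, eq. (1.4)**: in the
tree's orientation CHI's steps `a ↦ a + 2δ`, `a ↦ a + 2iδ` of the rotated face lattice are the
diagonal steps `v ↦ v + s`, `s = ±1 ± i`, of `δℤ²`, and (1.4) reads
`𝔼⁺[σ_{v+s}σ_x] / 𝔼⁺[σ_vσ_x] = 1 + δ Re[𝒜_Ω(δv; x) s] + o(δ)` uniformly on compacts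
(`Re[𝒜 s] = Re 𝒜 ∓ Im 𝒜` for `s = 1 ± i`: the two lines of (1.4)).

* `tendsto_meshIsingPlusCorr_ratio_of_spinorCoefficient` — CHI Prop 2.20 (`k = 1`, moving point)
  for one domain from Thm 1.5 (𝒜-form) and Remark 2.18;
* `chi_onePoint_rho_of_spinorCoefficient` — the named fact from Thm 1.5 (𝒜-form), Remark 2.18
  and Thm 1.7, each quantified over admissible approximable domains and conformal maps onto `ℍ`.

Everything here is proved; no new named facts.

## References

* D. Chelkak, C. Hongler, K. Izyurov, Ann. of Math. 181 (2015) = arXiv:1202.2838: Thm 1.5,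
  eq. (1.4)–(1.5), Remark 2.18, Thm 1.7, Prop 2.20, Remark 2.21, §§2.8–2.10 —
  `ChelkakHonglerIzyurovAnnals2015`.
-/

noncomputable section

open Filter Topology Metric Set Real Complex
open Literature.Probability.LatticeModels

namespace Literature.Probability.LatticeModels

/-- **CHI Prop. 2.20 (`k = 1`, moving point) from Thm 1.5 in `𝒜`-form and Remark 2.18**, for one
admissible domain, one conformal map `φ : Ω → ℍ` and one marked point `x`: if the discrete
logarithmic derivatives of `v ↦ 𝔼⁺_{Ω_δ}[σ_xσ_{δv}]` along the diagonal steps converge to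
`Re[𝒜_Ω(δv; x) s]` uniformly on compacts of `Ω ∖ {x}` (CHI15 Thm 1.5, eq. (1.4), with
`𝒜_Ω = ACHI φ`, eq. (1.5)) and the nearest-neighbour ratios tend to `1` (Remark 2.18), then
`𝔼⁺[σ_xσ_{y_δ}] / 𝔼⁺[σ_xσ_{y'}] → ⟨σ_xσ_{y₀}⟩⁺_Ω / ⟨σ_xσ_{y'}⟩⁺_Ω` whenever `y_δ → y₀`.
[cite: ChelkakHonglerIzyurovAnnals2015, Thm. 1.5, Remark 2.18, Prop. 2.20, Remark 2.21] -/
theorem tendsto_meshIsingPlusCorr_ratio_of_spinorCoefficient {Ω : Set ℂ} (hΩ : IsAdmissibleDomain Ω)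
    {φ : ℂ → ℂ} (hφ : IsConformalBijection φ Ω UpperHalfPlane.upperHalfPlaneSet) {x : ℂ} (hx : x ∈ Ω)
    (hdiag : ∀ K ⊆ Ω \ {x}, IsCompact K → ∀ s ∈ LatticeRatio.diagSteps, ∀ ε > (0 : ℝ), ∀ᶠ δ in 𝓝[>] (0 : ℝ),
      ∀ v : Site 2, meshPoint δ v ∈ K →
        |(meshIsingPlusCorr Ω δ ![x, meshPoint δ (v + s)] / meshIsingPlusCorr Ω δ ![x, meshPoint δ v] - 1) / δ -
          (ACHI φ (meshPoint δ v) x * Site.toComplex s).re| < ε)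
    (hnn : ∀ K ⊆ Ω \ {x}, IsCompact K → ∀ s ∈ LatticeRatio.nnSteps, ∀ ε > (0 : ℝ), ∀ᶠ δ in 𝓝[>] (0 : ℝ),
      ∀ v : Site 2, meshPoint δ v ∈ K →
        |meshIsingPlusCorr Ω δ ![x, meshPoint δ (v + s)] / meshIsingPlusCorr Ω δ ![x, meshPoint δ v] - 1| < ε)
    (y : ℝ → ℂ) {y₀ y' : ℂ} (hy₀ : y₀ ∈ Ω) (hy' : y' ∈ Ω) (hy₀x : y₀ ≠ x) (hy'x : y' ≠ x)
    (hy : Tendsto y (𝓝[>] 0) (𝓝 y₀)) :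
    Tendsto (fun δ => meshIsingPlusCorr Ω δ ![x, y δ] / meshIsingPlusCorr Ω δ ![x, y'])
      (𝓝[>] 0) (𝓝 (twoPointPlusCHI φ x y₀ / twoPointPlusCHI φ x y')) := by
  refine tendsto_meshIsingPlusCorr_ratio_of_logDerivative hΩ hφ hx ?_ hnn y hy₀ hy' hy₀x hy'x hy
  intro K hK hKc s hs ε hε
  filter_upwards [hdiag K hK hKc s hs ε hε] with δ hδ v hv
  rw [fderiv_log_twoPointPlusCHI_apply hΩ.1 hφ hx (hK hv).1
    (fun h => (hK hv).2 (Set.mem_singleton_iff.2 h))]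
  exact hδ v hv


/-- **CHI Theorem 1.1 (`+` and free, `ϱ`-normalised, pointwise) from Theorem 1.5 in its printed
`𝒜`-form, Remark 2.18 and Theorem 1.7** (same hypotheses as
`chi_onePoint_rho_of_spinorCoefficient`; conclusion as in `chi_twoPoint_rho_of_ratios`).
[cite: ChelkakHonglerIzyurovAnnals2015, Thm. 1.1, Thm. 1.5 eq. (1.4)–(1.5), Remark 2.18, Thm. 1.7, §2.9] -/
theorem chi_twoPoint_rho_of_spinorCoefficient
    (hD : ∀ (Ω : Set ℂ), IsAdmissibleDomain Ω → MeshApproximates Ω → ∀ (φ : ℂ → ℂ),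
      IsConformalBijection φ Ω UpperHalfPlane.upperHalfPlaneSet → ∀ x ∈ Ω,
        ∀ K ⊆ Ω \ {x}, IsCompact K → ∀ s ∈ LatticeRatio.diagSteps, ∀ ε > (0 : ℝ), ∀ᶠ δ in 𝓝[>] (0 : ℝ),
          ∀ v : Site 2, meshPoint δ v ∈ K →
            |(meshIsingPlusCorr Ω δ ![x, meshPoint δ (v + s)] / meshIsingPlusCorr Ω δ ![x, meshPoint δ v] - 1) / δ -
              (ACHI φ (meshPoint δ v) x * Site.toComplex s).re| < ε)
    (hN : ∀ (Ω : Set ℂ), IsAdmissibleDomain Ω → MeshApproximates Ω → ∀ (φ : ℂ → ℂ),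
      IsConformalBijection φ Ω UpperHalfPlane.upperHalfPlaneSet → ∀ x ∈ Ω,
        ∀ K ⊆ Ω \ {x}, IsCompact K → ∀ s ∈ LatticeRatio.nnSteps, ∀ ε > (0 : ℝ), ∀ᶠ δ in 𝓝[>] (0 : ℝ),
          ∀ v : Site 2, meshPoint δ v ∈ K →
            |meshIsingPlusCorr Ω δ ![x, meshPoint δ (v + s)] / meshIsingPlusCorr Ω δ ![x, meshPoint δ v] - 1| < ε)
    (hB : ∀ (Ω : Set ℂ), IsAdmissibleDomain Ω → MeshApproximates Ω → ∀ (φ : ℂ → ℂ),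
      IsConformalBijection φ Ω UpperHalfPlane.upperHalfPlaneSet →
        ∀ x ∈ Ω, ∀ (y : ℝ → ℂ) (y₀ : ℂ), y₀ ∈ Ω → y₀ ≠ x → Tendsto y (𝓝[>] 0) (𝓝 y₀) →
          Tendsto (fun δ => meshIsingFreeCorr Ω δ ![x, y δ] / meshIsingPlusCorr Ω δ ![x, y δ])
            (𝓝[>] 0) (𝓝 (bCHI (φ x) (φ y₀)))) :
    (∀ (Ω : Set ℂ), IsAdmissibleDomain Ω → MeshApproximates Ω → ∀ (φ : ℂ → ℂ),
      IsConformalBijection φ Ω UpperHalfPlane.upperHalfPlaneSet → ∀ x ∈ Ω, ∀ y ∈ Ω, x ≠ y →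
        Tendsto (fun δ => meshIsingPlusCorr Ω δ ![x, y] / rhoCHI δ) (𝓝[>] 0)
          (𝓝 (twoPointPlusCHI φ x y))) ∧
    (∀ (Ω : Set ℂ), IsAdmissibleDomain Ω → MeshApproximates Ω → ∀ (φ : ℂ → ℂ),
      IsConformalBijection φ Ω UpperHalfPlane.upperHalfPlaneSet → ∀ x ∈ Ω, ∀ y ∈ Ω, x ≠ y →
        Tendsto (fun δ => meshIsingFreeCorr Ω δ ![x, y] / rhoCHI δ) (𝓝[>] 0)
          (𝓝 (twoPointFreeCHI φ x y))) :=
  chi_twoPoint_rho_of_ratios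
    (fun Ω hΩ hM φ hφ x hx y _ _ hy₀ hy' hy₀x hy'x hy =>
      tendsto_meshIsingPlusCorr_ratio_of_spinorCoefficient hΩ hφ hx (hD Ω hΩ hM φ hφ x hx)
        (hN Ω hΩ hM φ hφ x hx) y hy₀ hy' hy₀x hy'x hy)
    hB

/-- **CHI Theorem 1.3 (`k = 0`), i.e. the named fact `chi_onePoint_rho`, from Theorem 1.5 in its
printed form.** Hypotheses, each for every admissible approximable `Ω`, every conformal bijection
`φ : Ω → ℍ` and every `x ∈ Ω`:
`hD` — CHI15 Thm 1.5, eq. (1.4): uniformly for `δv` in compacts of `Ω ∖ {x}`,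
`(𝔼⁺_{Ω_δ}[σ_xσ_{δ(v+s)}] / 𝔼⁺_{Ω_δ}[σ_xσ_{δv}] - 1)/δ - Re[𝒜_Ω(δv; x) s] → 0` for the four
diagonal steps `s`, where `𝒜_Ω = ACHI φ` is CHI's coefficient (1.5);
`hN` — Remark 2.18: the nearest-neighbour ratios tend to `1`;
`hB` — Thm 1.7, in the form CHI use it on p. 19 (proof of Thm 1.1, free case: "the fact that we
have `Ω_δ^• - δ` instead of `Ω_δ` plays no role"), i.e. for the free model on the faces of `Ω_δ`
(`meshIsingFreeCorr`): `𝔼^free[σ_xσ_{y_δ}] / 𝔼⁺[σ_xσ_{y_δ}] → 𝓑_Ω(x; y₀)` for `y_δ → y₀ ≠ x`.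
(Chain: this file & `LatticeRatioLimit` (Prop 2.20) & `PlanarIsingTwoPointProofs` (§2.9, Thm 1.1)
& `PlanarIsingOnePointProofs` (§2.10).) [cite: ChelkakHonglerIzyurovAnnals2015, Thm. 1.5 eq. (1.4)–(1.5), Remark 2.18, Thm. 1.7, §§2.8–2.10] -/
theorem chi_onePoint_rho_of_spinorCoefficient
    (hD : ∀ (Ω : Set ℂ), IsAdmissibleDomain Ω → MeshApproximates Ω → ∀ (φ : ℂ → ℂ),
      IsConformalBijection φ Ω UpperHalfPlane.upperHalfPlaneSet → ∀ x ∈ Ω,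
        ∀ K ⊆ Ω \ {x}, IsCompact K → ∀ s ∈ LatticeRatio.diagSteps, ∀ ε > (0 : ℝ), ∀ᶠ δ in 𝓝[>] (0 : ℝ),
          ∀ v : Site 2, meshPoint δ v ∈ K →
            |(meshIsingPlusCorr Ω δ ![x, meshPoint δ (v + s)] / meshIsingPlusCorr Ω δ ![x, meshPoint δ v] - 1) / δ -
              (ACHI φ (meshPoint δ v) x * Site.toComplex s).re| < ε)
    (hN : ∀ (Ω : Set ℂ), IsAdmissibleDomain Ω → MeshApproximates Ω → ∀ (φ : ℂ → ℂ),
      IsConformalBijection φ Ω UpperHalfPlane.upperHalfPlaneSet → ∀ x ∈ Ω,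
        ∀ K ⊆ Ω \ {x}, IsCompact K → ∀ s ∈ LatticeRatio.nnSteps, ∀ ε > (0 : ℝ), ∀ᶠ δ in 𝓝[>] (0 : ℝ),
          ∀ v : Site 2, meshPoint δ v ∈ K →
            |meshIsingPlusCorr Ω δ ![x, meshPoint δ (v + s)] / meshIsingPlusCorr Ω δ ![x, meshPoint δ v] - 1| < ε)
    (hB : ∀ (Ω : Set ℂ), IsAdmissibleDomain Ω → MeshApproximates Ω → ∀ (φ : ℂ → ℂ),
      IsConformalBijection φ Ω UpperHalfPlane.upperHalfPlaneSet →
        ∀ x ∈ Ω, ∀ (y : ℝ → ℂ) (y₀ : ℂ), y₀ ∈ Ω → y₀ ≠ x → Tendsto y (𝓝[>] 0) (𝓝 y₀) →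
          Tendsto (fun δ => meshIsingFreeCorr Ω δ ![x, y δ] / meshIsingPlusCorr Ω δ ![x, y δ])
            (𝓝[>] 0) (𝓝 (bCHI (φ x) (φ y₀)))) :
    chi_onePoint_rho := by
  refine chi_onePoint_rho_of_logDerivative ?_ hN hB
  intro Ω hΩ hM φ hφ x hx K hK hKc s hs ε hε
  filter_upwards [hD Ω hΩ hM φ hφ x hx K hK hKc s hs ε hε] with δ hδ v hv
  rw [fderiv_log_twoPointPlusCHI_apply hΩ.1 hφ hx (hK hv).1
    (fun h => (hK hv).2 (Set.mem_singleton_iff.2 h))]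
  exact hδ v hv

end Literature.Probability.LatticeModels
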